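import Summits.FinalStateConjecture.FinalStateConjecture.Theorems.EIHFluxBalanceInertialRecessionStubCoerMomQuantCompact

/-!
# Route EIHFluxBalance — `InertialRecession` (E′), line `SketchCleanExcision`, skeleton r13:
# registered stub `stub_coerMomQuant` (Bs) — quantitative, uniform, robust coercivity of the
# momentum rows of the modulated Kerr–Schild summand

File for the crux `stmt-FinalStateConjecture-17403`
(`Summit.FinalStateConjecture.FinalStateConjecture.Theses.EIHFluxBalance.InertialRecession`, E′),
registered stub `stub_coerMomQuant` (Bs) of skeleton r13 (design memo
`Cruxes/InertialRecession/Lines/SketchCleanExcision.md`). From the linearity clause (ML) of the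
momentum-row lemma and the qualitative kernel statement (Bk) — both taken as hypotheses — we
derive the quantitative statement: there are `c, ρin ≤ ρout, η₀ > 0` such that for every boost
with Lorentz factor `≤ γ`, every `η`-skew infinitesimal motion `(A, d)` and every background `G`
whose 2-jet is `η₀`-close to the painted summand's on the shell `ρin ≤ ‖y‖ ≤ ρout`, some offset
of the shell has momentum rows `≥ c · (‖Ae₀‖ + ‖d⃗‖ + ‖a·Ae₃‖)`.

Proof by compactness and contradiction (`…StubCoerMomQuantVar/Jets/Rows/Limit/Compact`): failing
data for `c = η₀ = 1/(n+1)`, `ρout = ρin + n + 1` are normalised modulo the Kerr–Schild stabiliser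
(`coerMomQ_normalise`); frames range in the compact set of `η`-isometries with bounded Lorentz
factor (`coer_isCompact_lorentzBounded_s0`) and normalised motions in a unit sphere of a
finite-dimensional space; along a convergent subsequence the rows converge
(`coerMomQ_limit_row_eq_zero`) to the rows of the painted summand with the limit frame and
motion, which therefore vanish at all far offsets; (Bk) forces the limit motion into the
stabiliser, hence to zero — contradicting its unit norm.

No definitions, no named facts, no `sorry`.
-/

set_option linter.dupNamespace false
set_option maxSynthPendingDepth 6
set_option synthInstance.maxHeartbeats 200000

noncomputable section

namespace Summit.FinalStateConjecture.FinalStateConjecture.Theorems.SublinearIsFree.Slaving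

open scoped BigOperators Topology Manifold ContDiff ENNReal
open Filter Set Function TopologicalSpace Metric Literature.Geometry.Lorentzian
  Literature.Geometry.Lorentzian.MetricCoord
open Summit.FinalStateConjecture.FinalStateConjecture.Theorems

set_option maxHeartbeats 1600000 in
/-- **(Bs) Quantitative, uniform, robust coercivity of the momentum rows.** For `|a| < M`,
`γ ≥ 1`, the linearity clause (ML) of the momentum-row lemma and the qualitative kernel statement
(Bk) imply: there are `c, η₀ > 0` and a shell `0 < ρin ≤ ρout` of lab offsets with painted radius
`> 2M` for every boost of Lorentz factor `≤ γ`, such that for every such boost `Λ`, every `η`-skew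
`A`, every `d`, and every field of metric components `G` whose 2-jet is `η₀`-close on the shell to
that of the painted summand `boostedKerrBilin Λ 0 M a`, some offset `y` of the shell satisfies
`c (‖Ae₀‖ + ‖d⃗‖ + ‖a • Ae₃‖) ≤ Σⱼ |Ric(G + x⁰Var)(♯dx⁰, e_{j+1}) − Ric(G)(♯dx⁰, e_{j+1})|` at
`(0, y)`. Compactness-and-contradiction over (frame, normalised motion), see the module docstring.
[folklore] -/
theorem stub_coerMomQuant :
    ∀ (M a γ : ℝ), |a| < M → 1 ≤ γ → (∀ {G G₁ G₂ G₃ : E4 → E4 →L[ℝ] E4 →L[ℝ] ℝ} {V : Set E4} {x : E4} {n : E4 →L[ℝ] ℝ} {A₁ A₂ : E4 →L[ℝ] E4 →L[ℝ] ℝ} {P₁ P₂ : E4 →L[ℝ] E4 →L[ℝ] E4 →L[ℝ] ℝ} {W₁ W₂ W₃ : E4 →L[ℝ] E4 →L[ℝ] ℝ} (c₁ c₂ : ℝ), MetricCoord.IsMetricOn G V → MetricCoord.IsMetricOn G₁ V → MetricCoord.IsMetricOn G₂ V → MetricCoord.IsMetricOn G₃ V → x ∈ V → G₁ x = G x → G₂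 x = G x → G₃ x = G x → fderiv ℝ G₁ x = fderiv ℝ G x + n.smulRight A₁ → fderiv ℝ G₂ x = fderiv ℝ G x + n.smulRight A₂ → fderiv ℝ G₃ x = fderiv ℝ G x + n.smulRight (c₁ • A₁ + c₂ • A₂) → (∀ v, fderiv ℝ (fderiv ℝ G₁) x v = fderiv ℝ (fderiv ℝ G) x v + (n v • P₁ + n.smulRight (P₁ v) + n v • n.smulRight W₁)) → (∀ v, fderiv ℝ (fderiv ℝ G₂) x v = fderiv ℝ (fderiv ℝ G) x v + (n v • P₂ + n.smulRight (P₂ v) + n v • n.smulRight W₂)) → (∀ v, fderiv ℝ (fderiv ℝ G₃) x v = fderiv ℝ (fderiv ℝ G) x v + (n v • (c₁ • P₁ + c₂ • P₂) + n.smulRight ((c₁ • P₁ + c₂ • P₂) v) + n v • n.smulRight W₃)) → ∀ e : E4, n e = 0 → MetricCoord.ricAt G₃ x (MetricCoord.sharpAt G x n) e - MetricCoord.ricAt G x (MetricCoord.sharpAt G x n) e = c₁ * (MetricCoord.ricAt G₁ x (MetricCoord.sharpAt G x n) e - MetricCoord.ricAt G x (MetricCoord.sharpAt G x n) e) + c₂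 * (MetricCoord.ricAt G₂ x (MetricCoord.sharpAt G x n) e - MetricCoord.ricAt G x (MetricCoord.sharpAt G x n) e)) ∧ (∀ μ ν : ℝ, 0 < μ → ∃ C : ℝ, ∀ {G G₁ : E4 → E4 →L[ℝ] E4 →L[ℝ] ℝ} {V : Set E4} {x : E4} {n : E4 →L[ℝ] ℝ} {A : E4 →L[ℝ] E4 →L[ℝ] ℝ} {P : E4 →L[ℝ] E4 →L[ℝ] E4 →L[ℝ] ℝ} {W : E4 →L[ℝ] E4 →L[ℝ] ℝ}, MetricCoord.IsMetricOn G V → MetricCoord.IsMetricOn G₁ V → x ∈ V → (∀ v : E4, μ * ‖v‖ ≤ ‖G x v‖) → ‖G x‖ ≤ ν → G₁ x = G x → fderiv ℝ G₁ x = fderiv ℝ G x + n.smulRight A → (∀ v, fderiv ℝ (fderiv ℝ G₁) x v = fderiv ℝ (fderiv ℝ G) x v + (n v • P + n.smulRight (P v) + n v • n.smulRight W)) → ∀ e : E4, n e = 0 → |MetricCoord.ricAt G₁ x (MetricCoord.sharpAt G x n) e - MetricCoord.ricAt G x (MetricCoord.sharpAt G x n) e| ≤ C * (1 + ‖fderiv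 ℝ G x‖) * (‖A‖ + ‖P‖) * ‖n‖ ^ 2 * ‖e‖) → (∀ (M a : ℝ), |a| < M → ∀ (L : lorentzGroup) (A : E4 →L[ℝ] E4) (d : E4) (ρ₀ : ℝ), (∀ u w : E4, Minkowski.bilin (A u) w + Minkowski.bilin u (A w) = 0) → (∀ y : E3, ρ₀ ≤ ‖y‖ → 2 * M < Kerr.radius a (poincareInv L 0 (E4.ofTimeSpace 0 y)) → ∀ j : Fin 3, MetricCoord.ricAt (fun z : E4 ↦ (boostedKerrBilin L 0 M a) z + (z 0) • ((fderiv ℝ (Kerr.bilin M a) (poincareInv L 0 z) (A (poincareInv L 0 z) + d)).bilinearComp (((L : E4 ≃L[ℝ] E4).symm : E4 →L[ℝ] E4)) (((L : E4 ≃L[ℝ] E4).symm : E4 →L[ℝ] E4)) + (Kerr.bilin M a (poincareInv L 0 z)).bilinearComp (A.comp (((L : E4 ≃L[ℝ] E4).symm : E4 →L[ℝ] E4))) (((L : E4 ≃L[ℝ] E4).symm : E4 →L[ℝ] E4)) + (Kerr.bilin M a (poincareInv L 0 z)).bilinearComp (((L : E4 ≃L[ℝ] E4).symm : E4 →L[ℝ]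 E4)) (A.comp (((L : E4 ≃L[ℝ] E4).symm : E4 →L[ℝ] E4))))) (E4.ofTimeSpace 0 y) (MetricCoord.sharpAt (boostedKerrBilin L 0 M a) (E4.ofTimeSpace 0 y) (E4.dx 0)) (E4.basisVector j.succ) = 0) → A (E4.basisVector 0) = 0 ∧ E4.spatial d = 0 ∧ (a ≠ 0 → A (E4.basisVector 3) = 0)) → (∃ c ρin ρout η₀ : ℝ, 0 < c ∧ 0 < η₀ ∧ 0 < ρin ∧ ρin ≤ ρout ∧ (∀ (L : lorentzGroup) (y : E3), |((L : E4 ≃L[ℝ] E4) (E4.basisVector 0)) 0| ≤ γ → ρin ≤ ‖y‖ → 2 * M < Kerr.radius a (poincareInv L 0 (E4.ofTimeSpace 0 y))) ∧ ∀ (L : lorentzGroup) (A : E4 →L[ℝ] E4) (d : E4) (G : E4 → E4 →L[ℝ] E4 →L[ℝ] ℝ) (V : Set E4), |((L : E4 ≃L[ℝ] E4) (E4.basisVector 0)) 0| ≤ γ → (∀ u w : E4, Minkowski.bilin (A u) w + Minkowski.bilin u (A w) = 0) → MetricCoord.IsMetricOn G V → (∀ y : E3, ρin ≤ ‖y‖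 → ‖y‖ ≤ ρout → (E4.ofTimeSpace 0 y) ∈ V ∧ ‖G (E4.ofTimeSpace 0 y) - boostedKerrBilin L 0 M a (E4.ofTimeSpace 0 y)‖ ≤ η₀ ∧ ‖fderiv ℝ G (E4.ofTimeSpace 0 y) - fderiv ℝ (boostedKerrBilin L 0 M a) (E4.ofTimeSpace 0 y)‖ ≤ η₀ ∧ ‖fderiv ℝ (fderiv ℝ G) (E4.ofTimeSpace 0 y) - fderiv ℝ (fderiv ℝ (boostedKerrBilin L 0 M a)) (E4.ofTimeSpace 0 y)‖ ≤ η₀) → ∃ y : E3, ρin ≤ ‖y‖ ∧ ‖y‖ ≤ ρout ∧ c * (‖A (E4.basisVector 0)‖ + ‖E4.spatial d‖ + ‖a • A (E4.basisVector 3)‖) ≤ ∑ j : Fin 3, |MetricCoord.ricAt (fun z : E4 ↦ G z + (z 0) • ((fderiv ℝ (Kerr.bilin M a) (poincareInv L 0 z) (A (poincareInv L 0 z) + d)).bilinearComp (((L : E4 ≃L[ℝ] E4).symm : E4 →L[ℝ] E4)) (((L : E4 ≃L[ℝ] E4).symm : E4 →L[ℝ] E4)) + (Kerr.bilin M a (poincareInv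 L 0 z)).bilinearComp (A.comp (((L : E4 ≃L[ℝ] E4).symm : E4 →L[ℝ] E4))) (((L : E4 ≃L[ℝ] E4).symm : E4 →L[ℝ] E4)) + (Kerr.bilin M a (poincareInv L 0 z)).bilinearComp (((L : E4 ≃L[ℝ] E4).symm : E4 →L[ℝ] E4)) (A.comp (((L : E4 ≃L[ℝ] E4).symm : E4 →L[ℝ] E4))))) (E4.ofTimeSpace 0 y) (MetricCoord.sharpAt G (E4.ofTimeSpace 0 y) (E4.dx 0)) (E4.basisVector j.succ) - MetricCoord.ricAt G (E4.ofTimeSpace 0 y) (MetricCoord.sharpAt G (E4.ofTimeSpace 0 y) (E4.dx 0)) (E4.basisVector j.succ)|) := by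
  intro M a γ hMa _hγ hML hBk
  have hM : 0 < M := (abs_nonneg a).trans_lt hMa
  -- the normal complement of the Kerr–Schild stabiliser inside the skew motions
  obtain ⟨Y, hYskew, hdec, hYker⟩ := coerMomQ_exists_normal_complement a
  -- far lab offsets have painted radius `> 2M`, for every boost
  set ρ : ℝ := |a| + (2 * M + 1) with hρ
  have hρpos : 0 < ρ := by positivity
  have hrad : ∀ (L : lorentzGroup) (y : E3), ρ ≤ ‖y‖ →
      2 * M < Kerr.radius a (poincareInv L 0 (E4.ofTimeSpace 0 y)) :=
    fun L y hy ↦ coerMomQ_radius_far hM.le a L hy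
  -- suppose the statement fails for `c = η₀ = 1/(n+1)`, `ρin = ρ`, `ρout = ρ + n + 1`, every `n`
  by_contra hcon
  push Not at hcon
  have H := fun n : ℕ ↦ hcon (1 / ((n : ℝ) + 1)) ρ (ρ + ((n : ℝ) + 1)) (1 / ((n : ℝ) + 1))
    (by positivity) (by positivity) hρpos (by linarith [(by positivity : (0 : ℝ) ≤ (n : ℝ) + 1)])
    (fun L y _ hy ↦ hrad L y hy)
  choose L A d G V hLγ hA hG hclose hbad using H
  -- the frame operators `Sₙ = Λₙ⁻¹`
  obtain ⟨S, hS⟩ : ∃ S : ℕ → E4 →L[ℝ] E4, ∀ n, S n = ((L n : E4 ≃L[ℝ] E4).symm : E4 →L[ℝ] E4) :=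
    ⟨_, fun n ↦ rfl⟩
  have hKS : ∀ n, boostedKerrBilin (L n) 0 M a = (fun z : E4 ↦ (Kerr.bilin M a ((S n) z)).bilinearComp (S n) (S n)) := fun n ↦ by
    rw [hS]; exact coerMomQ_boostedKerrBilin_eq_frame (L n) M a
  have hPI : ∀ n (z : E4), poincareInv (L n) 0 z = S n z := fun n z ↦ by
    rw [hS, coerMomQ_poincareInv_zero_eq]
  have hrS : ∀ n (y : E3), ρ ≤ ‖y‖ → 0 < Kerr.radius a (S n (E4.ofTimeSpace 0 y)) := by
    intro n y hy
    rw [← hPI]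
    linarith [hrad (L n) y hy]
  -- a point of every shell
  obtain ⟨y₀, hy₀⟩ : ∃ y₀ : E3, ‖y₀‖ = ρ :=
    ⟨EuclideanSpace.single 0 ρ, by rw [PiLp.norm_single, Real.norm_eq_abs, abs_of_pos hρpos]⟩
  -- normalise the failing motions
  have hnorm : ∀ n : ℕ, ∃ p ∈ Y, ‖p‖ = 1 ∧ ∀ y : E3, ρ ≤ ‖y‖ → ‖y‖ ≤ ρ + ((n : ℝ) + 1) →
      ∑ j : Fin 3, |(ricAt (fun z : E4 ↦ (G n) z + (z 0) • ((fderiv ℝ (Kerr.bilin M a) ((S n) z) (p.1 ((S n) z) + p.2)).bilinearComp (S n) (S n) + (Kerr.bilin M a ((S n) z)).bilinearComp (p.1.comp (S n)) (S n) + (Kerr.bilin M a ((S n) z)).bilinearComp (S n) (p.1.comp (S n)))) (E4.ofTimeSpace 0 y) (sharpAt (G n) (E4.ofTimeSpace 0 y) (E4.dx 0)) (E4.basisVector j.succ) - ricAt (G n) (E4.ofTimeSpace 0 y) (sharpAt (G n) (E4.ofTimeSpace 0 y) (E4.dx 0)) (E4.basisVector j.succ))| < 1 / ((n : ℝ) +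 1) * (1 + |a| + ‖E4.spatial‖) := by
    intro n
    refine coerMomQ_normalise hML.1 M a hdec (hG n) (S n) (hA n) (d n)
      ⟨y₀, hy₀.symm.le, by rw [hy₀]; linarith [(by positivity : (0 : ℝ) ≤ (n : ℝ) + 1)]⟩
      (fun y h1 h2 ↦ ⟨(hclose n y h1 h2).1, hrS n y h1⟩) fun y h1 h2 ↦ ?_
    have h := hbad n y h1 h2
    rw [← hS n] at h
    simp only [hPI n] at h
    exact h
  choose p hpY hp1 hsmall using hnorm
  -- compactness: frames with bounded Lorentz factor, normalised motions in the unit sphere of `Y`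
  have hKc := coer_isCompact_lorentzBounded_s0 γ
  have hSmem : ∀ n, S n ∈ {T : E4 →L[ℝ] E4 |
      (∀ v w, Minkowski.bilin (T v) (T w) = Minkowski.bilin v w) ∧ |T (E4.basisVector 0) 0| ≤ γ} := by
    intro n
    rw [hS]
    refine ⟨fun v w ↦ ?_, ?_⟩
    · have h := ((L n)⁻¹).2 v w
      rw [coe_lorentz_inv] at h
      exact h
    · have h := hLγ n
      rw [← lorentz_symm_apply_basisVector_zero (L n)] at h
      exact h
  have h𝒴c : IsCompact ((Y : Set ((E4 →L[ℝ] E4) × E4)) ∩ Metric.sphere 0 1) :=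
    (isCompact_sphere (0 : (E4 →L[ℝ] E4) × E4) 1).inter_left Y.closed_of_finiteDimensional
  have hpmem : ∀ n, p n ∈ (Y : Set ((E4 →L[ℝ] E4) × E4)) ∩ Metric.sphere 0 1 :=
    fun n ↦ ⟨hpY n, mem_sphere_zero_iff_norm.mpr (hp1 n)⟩
  obtain ⟨⟨S₀, p₀⟩, ⟨hS₀mem, hp₀mem⟩, φ, hφ, hlim⟩ :=
    (hKc.prod h𝒴c).tendsto_subseq (x := fun n ↦ (S n, p n)) fun n ↦ ⟨hSmem n, hpmem n⟩
  have hSlim : Tendsto (fun n ↦ S (φ n)) atTop (𝓝 S₀) :=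
    (continuous_fst.tendsto (S₀, p₀)).comp hlim
  have hplim : Tendsto (fun n ↦ p (φ n)) atTop (𝓝 p₀) :=
    (continuous_snd.tendsto (S₀, p₀)).comp hlim
  have hBlim : Tendsto (fun n ↦ (p (φ n)).1) atTop (𝓝 p₀.1) :=
    (continuous_fst.tendsto p₀).comp hplim
  have hclim : Tendsto (fun n ↦ (p (φ n)).2) atTop (𝓝 p₀.2) :=
    (continuous_snd.tendsto p₀).comp hplim
  -- the limit frame is `Λ₀⁻¹` for a Lorentz map `Λ₀`
  obtain ⟨L₀, hL₀S, -⟩ := coerMomQ_exists_lorentz_of_isometry hS₀mem.1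
  have hεφ : Tendsto (fun n ↦ 1 / ((φ n : ℝ) + 1)) atTop (𝓝 0) :=
    (tendsto_one_div_add_atTop_nhds_zero_nat (𝕜 := ℝ)).comp hφ.tendsto_atTop
  -- the rows of the limit data vanish at every far offset
  have hvan : ∀ y : E3, ρ ≤ ‖y‖ → ∀ j : Fin 3, (ricAt (fun z : E4 ↦ (fun z : E4 ↦ (Kerr.bilin M a (S₀ z)).bilinearComp S₀ S₀) z + (z 0) • ((fderiv ℝ (Kerr.bilin M a) (S₀ z) (p₀.1 (S₀ z) + p₀.2)).bilinearComp S₀ S₀ + (Kerr.bilin M a (S₀ z)).bilinearComp (p₀.1.comp S₀) S₀ + (Kerr.bilin M a (S₀ z)).bilinearComp S₀ (p₀.1.comp S₀))) (E4.ofTimeSpace 0 y) (sharpAt (fun z : E4 ↦ (Kerr.bilin M a (S₀ z)).bilinearComp S₀ S₀) (E4.ofTimeSpace 0 y) (E4.dx 0)) (E4.basisVector j.succ) - ricAt (fun z : E4 ↦ (Kerr.bilin M a (S₀ z)).bilinearComp S₀ S₀) (E4.ofTimeSpace 0 y) (sharpAt (fun z : E4 ↦ (Kerr.bilin M a (S₀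 z)).bilinearComp S₀ S₀) (E4.ofTimeSpace 0 y) (E4.dx 0)) (E4.basisVector j.succ)) = 0 := by
    intro y hy j
    have hx0 : (E4.ofTimeSpace 0 y) 0 = 0 := by simp
    have hr₀ := hrad L₀ y hy
    rw [coerMomQ_poincareInv_zero_eq, hL₀S] at hr₀
    have hrS₀ : 0 < Kerr.radius a (S₀ (E4.ofTimeSpace 0 y)) := by linarith
    have hK₀ : IsMetricOn (fun z : E4 ↦ (Kerr.bilin M a (S₀ z)).bilinearComp S₀ S₀) (poincareInv L₀ 0 ⁻¹' (Kerr.region a 0 : Set E4)) := by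
      have h := (isMetricOn_kerr_bilin M a).isMetricOn_pullMetric (isCoordChangeOn_poincareInv L₀ 0 a)
      rw [pullMetric_kerr_bilin_poincareInv, coerMomQ_boostedKerrBilin_eq_frame, hL₀S] at h
      exact h
    have hxU₀ : E4.ofTimeSpace 0 y ∈ poincareInv L₀ 0 ⁻¹' (Kerr.region a 0 : Set E4) := by
      show poincareInv L₀ 0 (E4.ofTimeSpace 0 y) ∈ (Kerr.region a 0 : Set E4)
      rw [SetLike.mem_coe, Kerr.mem_region, max_self, coerMomQ_poincareInv_zero_eq, hL₀S]
      exact hrS₀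
    -- the offset lies in the `n`-th shell eventually
    have hev : ∀ᶠ n in atTop, ‖y‖ ≤ ρ + ((φ n : ℝ) + 1) := by
      obtain ⟨N, hN⟩ := exists_nat_ge (‖y‖ - ρ)
      filter_upwards [eventually_ge_atTop N] with n hn
      have h1 : (N : ℝ) ≤ n := Nat.cast_le.mpr hn
      have h2 : (n : ℝ) ≤ φ n := Nat.cast_le.mpr hφ.le_apply
      linarith
    have hGV : ∀ᶠ n in atTop, IsMetricOn (G (φ n)) (V (φ n)) ∧ E4.ofTimeSpace 0 y ∈ V (φ n) := by
      filter_upwards [hev] with n hn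
      exact ⟨hG (φ n), (hclose (φ n) y hy hn).1⟩
    -- the 2-jets of `G_{φ n}` approach those of the painted summands
    have h0 : Tendsto (fun n ↦ G (φ n) (E4.ofTimeSpace 0 y)
        - (Kerr.bilin M a (S (φ n) (E4.ofTimeSpace 0 y))).bilinearComp (S (φ n)) (S (φ n)))
        atTop (𝓝 0) := by
      refine squeeze_zero_norm' ?_ hεφ
      filter_upwards [hev] with n hn
      have h := (hclose (φ n) y hy hn).2.1
      rw [hKS (φ n)] at h
      exact h
    have h1 : Tendsto (fun n ↦ fderiv ℝ (G (φ n)) (E4.ofTimeSpace 0 y)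
        - fderiv ℝ (fun z : E4 ↦ (Kerr.bilin M a ((S (φ n)) z)).bilinearComp (S (φ n)) (S (φ n))) (E4.ofTimeSpace 0 y)) atTop (𝓝 0) := by
      refine squeeze_zero_norm' ?_ hεφ
      filter_upwards [hev] with n hn
      have h := (hclose (φ n) y hy hn).2.2.1
      rw [hKS (φ n)] at h
      exact h
    have h2 : Tendsto (fun n ↦ fderiv ℝ (fderiv ℝ (G (φ n))) (E4.ofTimeSpace 0 y)
        - fderiv ℝ (fderiv ℝ (fun z : E4 ↦ (Kerr.bilin M a ((S (φ n)) z)).bilinearComp (S (φ n)) (S (φ n)))) (E4.ofTimeSpace 0 y)) atTop (𝓝 0) := by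
      refine squeeze_zero_norm' ?_ hεφ
      filter_upwards [hev] with n hn
      have h := (hclose (φ n) y hy hn).2.2.2
      rw [hKS (φ n)] at h
      exact h
    -- the rows along the subsequence are eventually `≤ C₀/(φ n + 1) → 0`
    have hsm : ∀ᶠ n in atTop, |(ricAt (fun z : E4 ↦ (G (φ n)) z + (z 0) • ((fderiv ℝ (Kerr.bilin M a) ((S (φ n)) z) ((p (φ n)).1 ((S (φ n)) z) + (p (φ n)).2)).bilinearComp (S (φ n)) (S (φ n)) + (Kerr.bilin M a ((S (φ n)) z)).bilinearComp ((p (φ n)).1.comp (S (φ n))) (S (φ n)) + (Kerr.bilin M a ((S (φ n)) z)).bilinearComp (S (φ n)) ((p (φ n)).1.comp (S (φ n))))) (E4.ofTimeSpace 0 y) (sharpAt (G (φ n)) (E4.ofTimeSpace 0 y) (E4.dx 0)) (E4.basisVector j.succ) - ricAt (G (φ n)) (E4.ofTimeSpace 0 y) (sharpAt (G (φ n)) (E4.ofTimeSpace 0 y) (E4.dx 0)) (E4.basisVector j.succ))| ≤ 1 / ((φ n : ℝ) + 1) * (1 + |a| + ‖E4.spatial‖) := by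
      filter_upwards [hev] with n hn
      have h := hsmall (φ n) y hy hn
      exact (Finset.single_le_sum (f := fun j : Fin 3 ↦ |(ricAt (fun z : E4 ↦ (G (φ n)) z + (z 0) • ((fderiv ℝ (Kerr.bilin M a) ((S (φ n)) z) ((p (φ n)).1 ((S (φ n)) z) + (p (φ n)).2)).bilinearComp (S (φ n)) (S (φ n)) + (Kerr.bilin M a ((S (φ n)) z)).bilinearComp ((p (φ n)).1.comp (S (φ n))) (S (φ n)) + (Kerr.bilin M a ((S (φ n)) z)).bilinearComp (S (φ n)) ((p (φ n)).1.comp (S (φ n))))) (E4.ofTimeSpace 0 y) (sharpAt (G (φ n)) (E4.ofTimeSpace 0 y) (E4.dx 0)) (E4.basisVector j.succ) - ricAt (G (φ n)) (E4.ofTimeSpace 0 y) (sharpAt (G (φ n)) (E4.ofTimeSpace 0 y) (E4.dx 0)) (E4.basisVector j.succ))|) (fun j _ ↦ abs_nonneg _)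
        (Finset.mem_univ j)).trans h.le
    have hε' : Tendsto (fun n ↦ 1 / ((φ n : ℝ) + 1) * (1 + |a| + ‖E4.spatial‖)) atTop (𝓝 0) := by
      simpa using hεφ.mul_const (1 + |a| + ‖E4.spatial‖)
    exact coerMomQ_limit_row_eq_zero M a hx0 hSlim hBlim hclim hrS₀ hK₀ hxU₀ hGV h0 h1 h2
      (E4.basisVector j.succ) hε' hsm
  -- hence the hypothesis of (Bk) for the limit motion painted with `Λ₀`
  have hBkhyp : ∀ y : E3, ρ ≤ ‖y‖ → 2 * M < Kerr.radius a (poincareInv L₀ 0 (E4.ofTimeSpace 0 y)) →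
      ∀ j : Fin 3, ricAt (fun z : E4 ↦ (boostedKerrBilin L₀ 0 M a) z + (z 0) • ((fderiv ℝ (Kerr.bilin M a) (poincareInv L₀ 0 z) (p₀.1 (poincareInv L₀ 0 z) + p₀.2)).bilinearComp (((L₀ : E4 ≃L[ℝ] E4).symm : E4 →L[ℝ] E4)) (((L₀ : E4 ≃L[ℝ] E4).symm : E4 →L[ℝ] E4)) + (Kerr.bilin M a (poincareInv L₀ 0 z)).bilinearComp (p₀.1.comp (((L₀ : E4 ≃L[ℝ] E4).symm : E4 →L[ℝ] E4))) (((L₀ : E4 ≃L[ℝ] E4).symm : E4 →L[ℝ] E4)) + (Kerr.bilin M a (poincareInv L₀ 0 z)).bilinearComp (((L₀ : E4 ≃L[ℝ] E4).symm : E4 →L[ℝ] E4)) (p₀.1.comp (((L₀ : E4 ≃L[ℝ] E4).symm : E4 →L[ℝ] E4)))))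
        (E4.ofTimeSpace 0 y) (sharpAt (boostedKerrBilin L₀ 0 M a) (E4.ofTimeSpace 0 y) (E4.dx 0))
        (E4.basisVector j.succ) = 0 := by
    intro y hy hr j
    have h := hvan y hy j
    have hz : ricAt (boostedKerrBilin L₀ 0 M a) (E4.ofTimeSpace 0 y)
        (sharpAt (boostedKerrBilin L₀ 0 M a) (E4.ofTimeSpace 0 y) (E4.dx 0)) (E4.basisVector j.succ) = 0 :=
      ricAt_boostedKerrBilin L₀ 0 M a (by linarith) _ _
    rw [coerMomQ_boostedKerrBilin_eq_frame, hL₀S] at hz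
    rw [hz, sub_zero] at h
    rw [coerMomQ_poincareInv_zero_eq, coerMomQ_boostedKerrBilin_eq_frame, hL₀S]
    exact h
  have hcomp := hBk M a hMa L₀ p₀.1 p₀.2 ρ (hYskew p₀ hp₀mem.1) hBkhyp
  have hp₀0 : p₀ = 0 := by
    refine hYker p₀ hp₀mem.1 hcomp.1 hcomp.2.1 ?_
    by_cases ha : a = 0
    · rw [ha, zero_smul]
    · rw [hcomp.2.2 ha, smul_zero]
  have hn1 : ‖p₀‖ = 1 := mem_sphere_zero_iff_norm.mp hp₀mem.2
  rw [hp₀0, norm_zero] at hn1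
  exact zero_ne_one hn1

end Summit.FinalStateConjecture.FinalStateConjecture.Theorems.SublinearIsFree.Slaving

end
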